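import Summits.QuantumAdvantage.QuantumAdvantage.Theorems.CubicForrelationNearExactIsExactSecondWeight

/-!
# Crux `CubicForrelation.NearExactIsExact` (stmt-QuantumAdvantage-14043) — brick: the SECOND weight of `RM(r,m)` for EVERY order `r ≥ 2`
  (no word of degree `≤ r` has weight strictly between `2^{m-r}` and `3·2^{m-r-1}`)

Certificate seat `b2b-cforr-cert` (gen 12).  HONEST FRAMING: an elementary coding-theory BRICK, uniform in `r` and `m`, standard axioms; it
formalises the classical fact (Berlekamp–Sloane 1969; contained in Kasami–Tokura 1970) that the second smallest weight of the Reed–Muller code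
`RM(r,m)` is `3·2^{m-r-1}` — here in the form: a non-zero Boolean function of degree `≤ r` with `2^{r+1}·wt < 3·2^m` has `2^r·wt = 2^m` (so it is
a minimum-weight word, hence an `(m−r)`-flat by `mw_flat_of_minweight`).  `…SecondWeight.lean` did `r = 2, 3`; this file does all `r ≥ 2` by
induction on `r` (the case `r = 4` is what the `n = 14` analysis of the crux needs: a degree-4 digit support `E` with `#E < 1536` on 14 bits is a
10-flat).  NOT summit progress.

Proof (induction on `r`, step `r → r+1`).  For `e` of degree `≤ r+1` with support `S`, `2^{r+2}#S < 3·2^m`: every derivative `D_a e` has degree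
`≤ r` and weight `δ(a) ≤ 2#S`, so `2^{r+1}δ(a) < 3·2^m` and by induction `δ(a) ∈ {0, 2^{m-r}}`; the master count (`sw_master`) gives
`2#S(2^m − #S) = 2^{m-r}(2^m − 2^j)` with `2^j` the number of periods, i.e. `(2^m − 2#S)² = 2^{2m} − 2^{2m-r+1} + 2^{m-r+1+j}`.  The Reed–Muller
bound `#S ≥ 2^{m-r-1}` forces `j ≤ m − r − 1`, and then the odd part of the right-hand side is `(2^{r-1} − 1)·2^k + 1` with `k = m − j ≥ r+1`;
it must be a perfect square (`sw_odd_part_sq`), and `b² − 1 = (2^{r-1} − 1)·2^k` factors as `(b−1)(b+1)` with one factor `2·odd` (`swa_factor`),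
which pins `k = r + 1` (`swa_dioph`), i.e. `2^j = 2^{m-r-1}`, `(2^m − 2#S)² = (2^m − 2^{m-r})²`, `#S = 2^{m-r-1}`.

References: E. R. Berlekamp, N. J. A. Sloane, *Restrictions on weight distribution of Reed–Muller codes*, Inform. Control 14 (1969) 442–456;
T. Kasami, N. Tokura, IEEE Trans. Inform. Theory 16 (1970) 752–759; MacWilliams–Sloane (1977) Ch. 15 §3.  Everything below is proved from
Mathlib and the tree; axioms are the standard three.
-/

set_option linter.dupNamespace false -- D-0017: single-problem summit ⇒ `QuantumAdvantage.QuantumAdvantage` by design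

noncomputable section

namespace Summit.QuantumAdvantage.QuantumAdvantage.Theorems.CubicForrelation.NearExactIsExact

open Finset
open Literature.Computability.QuantumComplexity
open Literature.Computability.QuantumComplexity.BuzetChailloux (bxor zeroVec bxor_bxor_cancel_left bxor_zeroVec zeroVec_bxor)

variable {m : ℕ}

/-! ### The Diophantine input: `b² = c·2^k + 1` with `c` odd -/

/-- **Factor structure of `b² − 1 = c·2^k`** (`k ≥ 2`): `c = u·w` with `u = 2^{k-2}w + 1` or `u + 1 = 2^{k-2}w` (`b` is odd, `b = 2b'+1`,
`b'(b'+1) = c·2^{k-2}`, and the odd one among `b', b'+1` is a divisor `u` of `c`). [folklore] -/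
theorem swa_factor {c k b : ℕ} (hk : 2 ≤ k) (h : b * b = c * 2 ^ k + 1) :
    ∃ u w, u * w = c ∧ (u = 2 ^ (k - 2) * w + 1 ∨ u + 1 = 2 ^ (k - 2) * w) := by
  obtain ⟨k', rfl⟩ : ∃ k', k = k' + 2 := ⟨k - 2, by omega⟩
  rw [Nat.add_sub_cancel]
  -- `b` is odd, `b = 2b' + 1`, `b'(b'+1) = c·2^{k'}`
  have hbodd : Odd b := by
    have hodd : Odd (b * b) := by
      rw [h]
      exact Even.add_odd ⟨c * 2 ^ (k' + 1), by rw [pow_succ]; ring⟩ odd_one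
    exact (Nat.odd_mul.1 hodd).1
  obtain ⟨b', rfl⟩ := hbodd
  have hprod : b' * (b' + 1) = c * 2 ^ k' := by
    have h4 : 4 * (b' * (b' + 1)) = 4 * (c * 2 ^ k') := by
      rw [pow_add] at h
      nlinarith [h]
    omega
  have hcop2 : ∀ n : ℕ, Odd n → Nat.Coprime n (2 ^ k') := fun n hn =>
    Nat.Coprime.pow_right k' ((Nat.Prime.coprime_iff_not_dvd Nat.prime_two).2 (fun h2 =>
      (Nat.not_even_iff_odd.2 hn) (even_iff_two_dvd.2 h2))).symm
  rcases Nat.even_or_odd b' with he | ho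
  · -- `b' + 1` is odd and divides `c`
    have hodd1 : Odd (b' + 1) := he.add_one
    have hdvd : b' + 1 ∣ c := (hcop2 _ hodd1).dvd_of_dvd_mul_right (Dvd.intro_left b' hprod)
    obtain ⟨w, hw⟩ := hdvd
    refine ⟨b' + 1, w, hw.symm, Or.inl ?_⟩
    have h1 : (b' + 1) * b' = (b' + 1) * (w * 2 ^ k') := by rw [mul_comm (b' + 1) b', hprod, hw]; ring
    have h2 : b' = w * 2 ^ k' := Nat.eq_of_mul_eq_mul_left (by omega) h1
    rw [h2]; ring
  · -- `b'` is odd and divides `c`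
    have hdvd : b' ∣ c := (hcop2 _ ho).dvd_of_dvd_mul_right (Dvd.intro _ hprod)
    obtain ⟨w, hw⟩ := hdvd
    have hb'pos : 0 < b' := by obtain ⟨x, rfl⟩ := ho; omega
    refine ⟨b', w, hw.symm, Or.inr ?_⟩
    have h1 : b' * (b' + 1) = b' * (w * 2 ^ k') := by rw [hprod, hw]; ring
    have h2 : b' + 1 = w * 2 ^ k' := Nat.eq_of_mul_eq_mul_left hb'pos h1
    rw [h2]; ring

/-- **`(2^{q+1} − 1)·2^k + 1` is a perfect square with `k ≥ q + 3` only for `k = q + 3`** (then it is `(2^{q+2} − 1)²`). [folklore] -/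
theorem swa_dioph {q k c b : ℕ} (hc : c + 1 = 2 ^ (q + 1)) (hk : q + 3 ≤ k) (hb : b * b = c * 2 ^ k + 1) : k = q + 3 := by
  have hcpos : 1 ≤ c := by
    have : 2 ≤ 2 ^ (q + 1) := by
      calc (2 : ℕ) = 2 ^ 1 := by norm_num
        _ ≤ 2 ^ (q + 1) := Nat.pow_le_pow_right (by norm_num) (by omega)
    omega
  obtain ⟨u, w, huw, hcase⟩ := swa_factor (by omega) hb
  have hpow : 2 ^ (q + 1) ≤ 2 ^ (k - 2) := Nat.pow_le_pow_right (by norm_num) (by omega)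
  have hwpos : 1 ≤ w := by
    rcases Nat.eq_zero_or_pos w with rfl | hw
    · rcases hcase with h | h
      · simp at huw; omega
      · simp at h
    · exact hw
  rcases hcase with h1 | h2
  · -- `u = 2^{k-2} w + 1 ≥ 2^{q+1} + 1 > c = u w ≥ u`
    exfalso
    have hu : u ≤ c := by rw [← huw]; exact Nat.le_mul_of_pos_right u hwpos
    have : 2 ^ (k - 2) * 1 ≤ 2 ^ (k - 2) * w := Nat.mul_le_mul_left _ hwpos
    omega
  · rcases Nat.lt_or_ge w 2 with hw1 | hw2
    · -- `w = 1`: `c + 1 = 2^{k-2}`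
      have hw : w = 1 := by omega
      subst hw
      rw [mul_one] at huw h2
      subst huw
      rw [h2] at hc
      have := Nat.pow_right_injective (le_refl 2) hc
      omega
    · -- `w ≥ 2`: `c = u w ≥ 2u = 2(2^{k-2} w − 1) ≥ 2^k − 2 > c`
      exfalso
      have hu2 : 2 * u ≤ c := by rw [← huw, mul_comm]; exact Nat.mul_le_mul_left u hw2
      have : 2 ^ (k - 2) * 2 ≤ 2 ^ (k - 2) * w := Nat.mul_le_mul_left _ hw2
      omega

/-! ### The second weight of `RM(r,m)`, all `r ≥ 2` -/

/-- **No weight of `RM(r,m)` strictly between `2^{m-r}` and `3·2^{m-r-1}`** (`r ≥ 2`; for `r = 1` see `sw_affine_card`): a non-zero Boolean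
function `e` of degree `≤ r` on `m` bits with `2^{r+1}·#{e = 1} < 3·2^m` has `2^r·#{e = 1} = 2^m`.
[cite: KasamiTokura1970, Thm 1] [cite: MacWilliamsSloane1977, Ch. 15 §3] -/
theorem sw_second_weight_all : ∀ (r : ℕ), 2 ≤ r → ∀ (m : ℕ) (e : (Fin m → Bool) → Bool), IsDegLeFun r e → (∃ x, e x = true) →
    2 ^ (r + 1) * #(univ.filter fun x => e x = true) < 3 * 2 ^ m → 2 ^ r * #(univ.filter fun x => e x = true) = 2 ^ m := by
  intro r hr
  induction r, hr using Nat.le_induction with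
  | base =>
    intro m e he hne hlt
    have h := sw_quadratic_second_weight e he hne (by norm_num at hlt ⊢; omega)
    norm_num; omega
  | succ r hr ih =>
    intro m e he hne hlt
    classical
    have hSpos : 0 < #(univ.filter fun x => e x = true) := by
      obtain ⟨x, hx⟩ := hne
      exact card_pos.2 ⟨x, mem_filter.2 ⟨mem_univ _, hx⟩⟩
    -- `r = q + 2`, `c + 1 = 2^{q+1}`
    obtain ⟨q, rfl⟩ : ∃ q, r = q + 2 := ⟨r - 2, by omega⟩
    obtain ⟨c, hc⟩ : ∃ c, c + 1 = 2 ^ (q + 1) := ⟨2 ^ (q + 1) - 1, by have := Nat.one_le_two_pow (n := q + 1); omega⟩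
    -- `m = p + r + 1`
    have hRM := bb_rmWeight_holds m (q + 2 + 1) e he hne
    obtain ⟨p, rfl⟩ : ∃ p, m = p + (q + 3) := by
      have h1 : 2 ^ (q + 2 + 1 + 1) ≤ 2 ^ (q + 2 + 1 + 1) * #(univ.filter fun x => e x = true) :=
        Nat.le_mul_of_pos_right _ hSpos
      have h2 : 2 ^ (q + 2 + 1 + 1) < 2 ^ (m + 2) := by
        calc 2 ^ (q + 2 + 1 + 1) < 3 * 2 ^ m := lt_of_le_of_lt h1 hlt
          _ ≤ 2 ^ (m + 2) := by rw [pow_add]; norm_num; omega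
      have h3 := (Nat.pow_lt_pow_iff_right (by norm_num : 1 < 2)).1 h2
      exact ⟨m - (q + 3), by omega⟩
    -- the minimum weight `d = 2^p`
    have hSd : 2 ^ p ≤ #(univ.filter fun x => e x = true) := by
      have h1 : 2 ^ (p + (q + 3)) = 2 ^ (q + 2 + 1) * 2 ^ p := by ring
      rw [h1] at hRM
      exact Nat.le_of_mul_le_mul_left hRM (by positivity)
    -- every derivative has weight `0` or `2^{p+1}`
    have hK : ∀ a, #(univ.filter fun x => (e x ^^ e (bxor x a)) = true) = 0 ∨
        #(univ.filter fun x => (e x ^^ e (bxor x a)) = true) = 2 ^ (p + 1) := by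
      intro a
      have hdeg : IsDegLeFun (q + 2) (fun x => e x ^^ e (bxor x a)) := stub_derivDegree _ (q + 2) e a he
      have hle := sw_deriv_card_le e a
      by_cases hz : #(univ.filter fun x => (e x ^^ e (bxor x a)) = true) = 0
      · exact Or.inl hz
      · right
        obtain ⟨x, hx⟩ : ∃ x, (e x ^^ e (bxor x a)) = true := by
          by_contra hno
          push Not at hno
          exact hz (card_eq_zero.2 (filter_eq_empty_iff.2 fun x _ => hno x))
        have hlt' : 2 ^ (q + 2 + 1) * #(univ.filter fun x => (e x ^^ e (bxor x a)) = true) < 3 * 2 ^ (p + (q + 3)) := by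
          have e2 : 2 ^ (q + 2 + 1 + 1) = 2 * 2 ^ (q + 2 + 1) := by ring
          rw [e2] at hlt
          calc 2 ^ (q + 2 + 1) * #(univ.filter fun x => (e x ^^ e (bxor x a)) = true)
              ≤ 2 ^ (q + 2 + 1) * (2 * #(univ.filter fun x => e x = true)) := Nat.mul_le_mul_left _ hle
            _ = 2 * 2 ^ (q + 2 + 1) * #(univ.filter fun x => e x = true) := by ring
            _ < 3 * 2 ^ (p + (q + 3)) := hlt
        have h := ih (p + (q + 3)) _ hdeg ⟨x, hx⟩ hlt'
        have h' : 2 ^ (q + 2) * #(univ.filter fun x => (e x ^^ e (bxor x a)) = true) = 2 ^ (q + 2) * 2 ^ (p + 1) := by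
          rw [h]; ring
        exact Nat.eq_of_mul_eq_mul_left (by positivity) h'
    obtain ⟨j, hj, hmaster⟩ := sw_master e (2 ^ (p + 1)) hK
    -- `t = 2^m − 2#S`
    have h2S : 2 * #(univ.filter fun x => e x = true) ≤ 2 ^ (p + (q + 3)) := by
      have h16 : 16 * #(univ.filter fun x => e x = true) ≤ 2 ^ (q + 2 + 1 + 1) * #(univ.filter fun x => e x = true) :=
        Nat.mul_le_mul_right _ (by
          calc (16 : ℕ) = 2 ^ 4 := by norm_num
            _ ≤ 2 ^ (q + 2 + 1 + 1) := Nat.pow_le_pow_right (by norm_num) (by omega))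
      omega
    obtain ⟨t, ht⟩ : ∃ t, t + 2 * #(univ.filter fun x => e x = true) = 2 ^ (p + (q + 3)) :=
      ⟨2 ^ (p + (q + 3)) - 2 * #(univ.filter fun x => e x = true), by omega⟩
    have hjle : 2 ^ j ≤ 2 ^ (p + (q + 3)) := Nat.pow_le_pow_right (by norm_num) hj
    have hs : #(univ.filter fun x => e x = true) ≤ 2 ^ (p + (q + 3)) := by omega
    have htsq : (t : ℤ) ^ 2 = (2 : ℤ) ^ (2 * (p + (q + 3))) - 4 * 2 ^ p * 2 ^ (p + (q + 3)) + 4 * 2 ^ p * 2 ^ j := by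
      zify [hjle, hs] at hmaster ht
      have ht' : (t : ℤ) = 2 ^ (p + (q + 3)) - 2 * (#(univ.filter fun x => e x = true) : ℤ) := by linarith
      rw [ht']
      have e1 : (2 : ℤ) ^ (p + (q + 3)) = 2 ^ (p + 1) * 2 ^ (q + 2) := by ring
      linear_combination (-2 : ℤ) * hmaster
    -- `v ≤ d`: `j ≤ p`
    have hjp : j ≤ p := by
      have htle : (t : ℤ) ≤ 2 ^ (p + (q + 3)) - 2 * 2 ^ p := by
        have : t + 2 * 2 ^ p ≤ 2 ^ (p + (q + 3)) := by omega
        have h' : ((t + 2 * 2 ^ p : ℕ) : ℤ) ≤ ((2 ^ (p + (q + 3)) : ℕ) : ℤ) := by exact_mod_cast this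
        push_cast at h'
        linarith
      have ht0 : (0 : ℤ) ≤ t := by positivity
      have hsq : (t : ℤ) ^ 2 ≤ (2 ^ (p + (q + 3)) - 2 * 2 ^ p) ^ 2 := by nlinarith
      rw [htsq] at hsq
      have e4 : ((2 : ℤ) ^ (p + (q + 3)) - 2 * 2 ^ p) ^ 2 =
          2 ^ (2 * (p + (q + 3))) - 4 * 2 ^ p * 2 ^ (p + (q + 3)) + 4 * 2 ^ p * 2 ^ p := by ring
      rw [e4] at hsq
      have h4 : (4 : ℤ) * 2 ^ p * 2 ^ j ≤ 4 * 2 ^ p * 2 ^ p := by linarith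
      have hv : (2 : ℤ) ^ j ≤ 2 ^ p := le_of_mul_le_mul_left h4 (by positivity)
      have hv' : (2 : ℕ) ^ j ≤ 2 ^ p := by exact_mod_cast hv
      exact (Nat.pow_le_pow_iff_right (by norm_num : 1 < 2)).1 hv'
    obtain ⟨i, rfl⟩ : ∃ i, p = j + i := ⟨p - j, by omega⟩
    -- the odd part of `t²` is `c·2^{i+q+3} + 1`
    have htsq' : t * t = 2 ^ (2 * j + i + 2) * (c * 2 ^ (i + q + 3) + 1) := by
      have hc' : (c : ℤ) = 2 ^ (q + 1) - 1 := by
        have : ((c + 1 : ℕ) : ℤ) = ((2 ^ (q + 1) : ℕ) : ℤ) := by exact_mod_cast hc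
        push_cast at this; linarith
      have h' : ((t * t : ℕ) : ℤ) = ((2 ^ (2 * j + i + 2) * (c * 2 ^ (i + q + 3) + 1) : ℕ) : ℤ) := by
        push_cast
        rw [← pow_two, htsq, hc']
        ring
      exact_mod_cast h'
    obtain ⟨b, hb⟩ := sw_odd_part_sq (by exact Even.add_odd ⟨c * 2 ^ (i + q + 2), by rw [pow_succ]; ring⟩ odd_one) htsq'
    have hk := swa_dioph hc (by omega) hb
    have hi : i = 0 := by omega
    subst hi
    -- `v = d`: `t² = (2^m − 2d)²`, `#S = d`
    have htsq2 : (t : ℤ) ^ 2 = ((2 : ℤ) ^ (j + 0 + (q + 3)) - 2 * 2 ^ (j + 0)) ^ 2 := by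
      rw [htsq]; ring
    have ht0 : (0 : ℤ) ≤ t := by positivity
    have hR : (0 : ℤ) ≤ (2 : ℤ) ^ (j + 0 + (q + 3)) - 2 * 2 ^ (j + 0) := by
      have : (2 : ℤ) * 2 ^ (j + 0) ≤ 2 ^ (j + 0 + (q + 3)) := by
        rw [show (2 : ℤ) ^ (j + 0 + (q + 3)) = 2 ^ (j + 0) * 2 ^ (q + 3) by ring]
        have : (2 : ℤ) ≤ 2 ^ (q + 3) := by
          calc (2 : ℤ) = 2 ^ 1 := by norm_num
            _ ≤ 2 ^ (q + 3) := pow_le_pow_right₀ (by norm_num) (by omega)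
        nlinarith [pow_pos (show (0:ℤ) < 2 by norm_num) (j + 0)]
      linarith
    have hteq : (t : ℤ) = 2 ^ (j + 0 + (q + 3)) - 2 * 2 ^ (j + 0) := by
      have := (sq_eq_sq₀ ht0 hR).1 htsq2
      exact this
    have hSj : (#(univ.filter fun x => e x = true) : ℤ) = 2 ^ (j + 0) := by
      zify at ht
      linarith
    have hSj' : #(univ.filter fun x => e x = true) = 2 ^ (j + 0) := by exact_mod_cast hSj
    rw [hSj']
    ring

end Summit.QuantumAdvantage.QuantumAdvantage.Theorems.CubicForrelation.NearExactIsExact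

end
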